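import Literature.MathematicalPhysics.QuantumFieldTheory.Balaban1983to89.Beta.RemainderChainLattice

/-!
# `Balaban1983to89.Beta.RemainderConstNumerals` — the k-FREE numbers inside the valued remainder coefficient, EXACTLY:
`K₀(64, 8) = 2⁶⁴·3²⁵²`, the three thresholds of the concrete carrier at d = 4 in closed form, the lattice constant
`K₁(d, a) = Σ_{z∈ℤ^d} e^{−a|z|₁} = ((1 + e^{−a})/(1 − e^{−a}))^d` in closed form, and an ELEMENTARY closed-form majorant of
`K_rem,L = remCoeffL d M c α₂ B₃` (no infinite sum left), hence the k-uniform constant-form remainder bound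
`|β¹_{k+1}| ≤ ε₁ · E(d, M, printed letters)` with `E` a rational function of exponentials of the printed letters,
and (v1.1, §6) the lattice moments `Σ_{x∈ℤ^d} |x|₁^j e^{−t|x|₁}` (j = 0, 1, 2) — hence `betaPrime510 d C δ₁` and
`remCoeffL 4 M c α₂ B₃` themselves — EXACTLY, as rational functions of `e^{−t}`
(cell `pub-balaban`, β sub-cell acceleration lane asym2 = unit `b2b-balaban-beta-asym2`; companion of
`Beta.RemainderChainLattice` (row BETA-an4's concrete carrier) and of the lane memo `HOME/BETA/ASYM2.md`).

HONEST FRAMING (cell rule, verbatim, page 1 of everything): discharging `BetaPertH` makes Bałaban's UV stability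
UNCONDITIONAL — a real constructive-QFT result; it is NOT the continuum limit and NOT the Clay problem.  THIS MODULE
DISCHARGES NOTHING about Bałaban's β-functions: every theorem is real-number algebra over the tree's DEFINITIONS
(`B12TreeDecay.a₀/kappa₀/K₀`, `B12Decay510Window.K₁`, `B12Sec2to5.l1/betaPrime510`, `B12Decay510.delta1`,
`Beta.RemainderChainLattice.deltaL/polConstL/remCoeffL/kappaThresholdL/a2ThresholdL/eps1ThresholdL`) and one corollary
re-packaging `RemainderChainLattice.ChainL.abs_beta1_le` (a theorem over the HYPOTHESIS structure `ChainL`, whose instance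
for Bałaban's split is the located leaf list — cell GAPS G-B13-07…10, G-B12s-15, G-adv2-2 — and is NOT supplied here).
ABSOLUTE RULE (cell rule, verbatim): "No internally-minted statement may enter as a cited fact. Every hypothesis is
either kernel-proved in this package or a verbatim quotation of a PUBLISHED theorem with page reference. The
manuscript(s) under audit are NOT citable for their own disputed steps — they are the thing under adjudication;
programme-internal (2001/route/tribunal) claims are never citable."  Accordingly nothing below is cited as a fact of the
papers: the `[cite: …]` tags point at the printed CONTEXT of a definition being evaluated ((5.10) p.293 of [I] for δ₁ and
the lattice sums; p.21 of [II] for the thresholds), never at a proof.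

WHY (lane memo `BETA/ASYM2.md` §2–§3): the constant r of `RemainderChain.RemainderConst S γ r` delivered by the printed
chain is `r = ε₁ · remCoeffL d M c α₂ B₃`, k-FREE BY CLOSED FORMULA (`RemainderChainLattice.remCoeffL_eq`): there is no
k-indexed quantity to certify and no large-k estimate to prove on the remainder side; what CAN be made explicit are the
pure numbers of the geometric skeleton and the two lattice sums — done here in the kernel (the decimal enclosures
κ₀ = 64 log 162 ∈ [325.606165, 325.606166], log₁₀ K₀(64,8) ∈ [139.5004, 139.5005], a2ThresholdL 4 ∈ [1.569165, 1.569166]·10²⁸²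
are in the lane's two-engine certificate `HOME/b2b-balaban-beta-asym2/remconst_numerals.json`, NOT asserted in Lean).

CONTENTS.  §1 `Σ_{m∈ℤ} e^{−a|m|} = (1 + e^{−a})/(1 − e^{−a})` (a > 0; geometric series on ℕ and on −ℕ₊,
`HasSum.of_nat_of_neg_add_one`).  §2 `K₁ d a = ((1 + e^{−a})/(1 − e^{−a}))^d` (product structure via `Fin.consEquiv` and
`tsum_mul_tsum_of_summable_norm`, induction on d) and the coth bound `(1 + e^{−a})/(1 − e^{−a}) ≤ 1 + 2/a` (from
`1 + a ≤ e^a`), so `K₁ d a ≤ (1 + 2/a)^d`.  §3 the (5.10)·(5.42) majorant sum: `Σ_{x∈ℤ^d} |x|₁² e^{−t|x|₁} ≤ (16/t²)·K₁(d, t/2)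
≤ (16/t²)(1 + 4/t)^d` (`B12Sec2to5.sq_mul_exp_neg_le`).  §4 d = 4 numerals: `e^{64 log 162} = 162⁶⁴`, `K₀(4·2⁴, 2·4) = K₀ 64 8
= 162⁶⁴/81 = 2⁶⁴·3²⁵²`, `a2ThresholdL 4 = 576·e·(2⁶⁴3²⁵²)²`, `eps1ThresholdL 4 κ = (576·2⁶⁴3²⁵²·e^{5κ+1})⁻¹`,
`kappaThresholdL 4 ℓ = 10(64 log 162 + 1)/(ℓ − 1)` for `1 < ℓ ≤ 6` (the Kotecký–Preiss entry dominates the tree entry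
`128 log 162`), `CondsL 4` in numerals.  §5 `remCoeffL 4` with the numeral, the elementary majorant `elemCoeffL` (general d and
d = 4) with `ε₁·remCoeffL ≤ ε₁·elemCoeffL` under the chain's own conditions, and the corollary
`ChainL.abs_beta1_le_elem : … → RemainderConst S γ (ε₁ · elemCoeffL d M c α₂ B₃)`.  §6 (v1.1) the moments EXACTLY:
with `mom₀ t = (1 + e^{−t})/(1 − e^{−t})`, `mom₁ t = 2e^{−t}/(1 − e^{−t})²`, `mom₂ t = 2e^{−t}(1 + e^{−t})/(1 − e^{−t})³`
(= `Σ_{m∈ℤ} |m|^j e^{−t|m|}`, j = 0, 1, 2; `Σ_{n≥0} n²qⁿ = q(1 + q)/(1 − q)³` from Mathlib's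
`hasSum_choose_mul_geometric_of_norm_lt_one`), for t > 0: `Σ_{x∈ℤ^d} |x|₁ e^{−t|x|₁} = d·mom₁·mom₀^{d−1}`,
**`Σ_{x∈ℤ^d} |x|₁² e^{−t|x|₁} = d·mom₂·mom₀^{d−1} + d(d−1)·mom₁²·mom₀^{d−2}`** (product structure as in §2, induction on d),
at d = 4 `= 4mom₂mom₀³ + 12mom₁²mom₀² = 8q(1 + q)²(1 + 8q + q²)/(1 − q)⁶` (q = e^{−t}); hence `betaPrime510 d C δ₁` and
`remCoeffL 4 M c α₂ B₃` with NO infinite sum and NO inequality (`betaPrime510_eq_closed`, `remCoeffL_four_eq_closed`).  The §3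
majorants overshoot the exact d = 4 moment by factors 12.5–63 on t ∈ [1/8, 3] (lane two-engine table, GAPS C-asym2g16-1 (b);
decimals NOT asserted in Lean).
NOT HERE: any instance of `ChainL` (the leaves), any decimal numeral as a Lean inequality, anything about β⁰ (one loop).
VERSIONS.  v1 (lane gen 5, p183735): §1–§5.  v1.1 (lane gen 16): + §6, APPEND-ONLY — v1's declarations byte-identical.

CITATION HEADER (lean-in-tree rule).  T. Bałaban, *Renormalization group approach to lattice gauge field theories. I.
Generation of effective actions in a small field approximation and a coupling constant renormalization*, Commun. Math.
Phys. **109**, 249–301 (1987) [Balaban1987RG1] = [I], p. 293, (5.10): *"|Π_{μν}(x − y)| ≤ O(1)E₀ exp(−δ₁|x − y|), with a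
positive constant δ₁ determined by δ₀, κ, and M (e.g., δ₁ = ½min{δ₀, κM⁻¹})"* (typed `B12Decay510.delta1`,
`B12Sec2to5.betaPrime510`); T. Bałaban, *Renormalization group approach to lattice gauge field theories. II. Cluster
expansions*, Commun. Math. Phys. **116**, 1–22 (1988) [Balaban1988RG2Cluster] = [II], p. 21 after (2.39)/(2.41): *"κ
sufficiently large"*, *"ε₁ sufficiently small"*, *"(1 − 10δ)½L = 1"* (typed as the fields of `RemainderChainLattice.CondsL`
and `B13.Consts.R22gen`).  The constants `a₀, κ₀, K₀` are the tree's explicit animal-sum constants after [Dimock2013]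
App. A Lemma 25 (`B12TreeDecay`), evaluated here at (c₀, Δ) = (64, 8) = (4·2⁴, 2·4).
-/

namespace Literature.MathematicalPhysics.QuantumFieldTheory.Balaban1983to89.Beta.RemainderConstNumerals

open Literature.MathematicalPhysics.QuantumFieldTheory.Balaban1983to89
open Literature.MathematicalPhysics.QuantumFieldTheory.Balaban1983to89.B12Sec2to5
  (l1 l1_nonneg summable_exp_neg_abs_int summable_exp_neg_l1 majorant_summable sq_mul_exp_neg_le betaPrime510)
open Literature.MathematicalPhysics.QuantumFieldTheory.Balaban1983to89.B12Decay510Window (K₁ K₁_nonneg)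
open Literature.MathematicalPhysics.QuantumFieldTheory.Balaban1983to89.B12TreeDecay (kappa₀ a₀ K₀ K₀_pos kappa₀_nonneg)
open Literature.MathematicalPhysics.QuantumFieldTheory.Balaban1983to89.TreeLengthCubeSystem (kappa₀_four)
open Literature.MathematicalPhysics.QuantumFieldTheory.Balaban1983to89.B12Decay510 (delta1 delta1_pos)
open Literature.MathematicalPhysics.QuantumFieldTheory.Balaban1983to89.Beta.RemainderChain
open Literature.MathematicalPhysics.QuantumFieldTheory.Balaban1983to89.Beta.RemainderChainLattice
open FlowStep

noncomputable section

variable {d : ℕ}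

/-! ## 1. The one-dimensional lattice sum `Σ_{m∈ℤ} e^{−a|m|} = (1 + e^{−a})/(1 − e^{−a})` -/

/-- The ℕ-part: `Σ_{n≥0} e^{−a n} = (1 − e^{−a})⁻¹` for a > 0 (geometric series). [folklore] -/
theorem hasSum_exp_neg_abs_nat {a : ℝ} (ha : 0 < a) :
    HasSum (fun n : ℕ => Real.exp (-a * |((n : ℤ) : ℝ)|)) (1 - Real.exp (-a))⁻¹ := by
  have hq0 : 0 ≤ Real.exp (-a) := (Real.exp_pos _).le
  have hq1 : Real.exp (-a) < 1 := Real.exp_lt_one_iff.mpr (by linarith)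
  have heq : (fun n : ℕ => Real.exp (-a * |((n : ℤ) : ℝ)|)) = fun n : ℕ => Real.exp (-a) ^ n := by
    funext n
    rw [Int.cast_natCast, abs_of_nonneg (Nat.cast_nonneg n), ← Real.exp_nat_mul]
    ring_nf
  rw [heq]
  exact hasSum_geometric_of_lt_one hq0 hq1

/-- The (−ℕ₊)-part: `Σ_{n≥0} e^{−a(n+1)} = e^{−a}(1 − e^{−a})⁻¹` for a > 0. [folklore] -/
theorem hasSum_exp_neg_abs_negSucc {a : ℝ} (ha : 0 < a) :
    HasSum (fun n : ℕ => Real.exp (-a * |(((-(n + 1 : ℤ)) : ℤ) : ℝ)|)) (Real.exp (-a) * (1 - Real.exp (-a))⁻¹) := by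
  have hq0 : 0 ≤ Real.exp (-a) := (Real.exp_pos _).le
  have hq1 : Real.exp (-a) < 1 := Real.exp_lt_one_iff.mpr (by linarith)
  have heq : (fun n : ℕ => Real.exp (-a * |(((-(n + 1 : ℤ)) : ℤ) : ℝ)|)) =
      fun n : ℕ => Real.exp (-a) * Real.exp (-a) ^ n := by
    funext n
    have hn : |(((-(n + 1 : ℤ)) : ℤ) : ℝ)| = (n : ℝ) + 1 := by
      push_cast
      rw [abs_neg]
      exact abs_of_nonneg (by positivity)
    rw [hn, ← Real.exp_nat_mul, ← Real.exp_add]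
    ring_nf
  rw [heq]
  exact (hasSum_geometric_of_lt_one hq0 hq1).mul_left _

/-- `Σ_{m∈ℤ} e^{−a|m|} = (1 + e^{−a})/(1 − e^{−a})` (= coth(a/2)) for a > 0. [folklore] -/
theorem hasSum_exp_neg_abs_int {a : ℝ} (ha : 0 < a) :
    HasSum (fun n : ℤ => Real.exp (-a * |(n : ℝ)|)) ((1 + Real.exp (-a)) / (1 - Real.exp (-a))) := by
  have hq1 : Real.exp (-a) < 1 := Real.exp_lt_one_iff.mpr (by linarith)
  have h1q : (1 : ℝ) - Real.exp (-a) ≠ 0 := by linarith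
  have h := HasSum.of_nat_of_neg_add_one (f := fun n : ℤ => Real.exp (-a * |(n : ℝ)|))
    (hasSum_exp_neg_abs_nat ha) (hasSum_exp_neg_abs_negSucc ha)
  have hval : (1 - Real.exp (-a))⁻¹ + Real.exp (-a) * (1 - Real.exp (-a))⁻¹ =
      (1 + Real.exp (-a)) / (1 - Real.exp (-a)) := by
    field_simp
  rw [hval] at h
  exact h

/-- `Σ'_{m∈ℤ} e^{−a|m|} = (1 + e^{−a})/(1 − e^{−a})` for a > 0 (tsum form). [folklore] -/
theorem tsum_exp_neg_abs_int {a : ℝ} (ha : 0 < a) :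
    ∑' n : ℤ, Real.exp (-a * |(n : ℝ)|) = (1 + Real.exp (-a)) / (1 - Real.exp (-a)) :=
  (hasSum_exp_neg_abs_int ha).tsum_eq

/-! ## 2. The cube-sum constant `K₁(d, a) = Σ_{z∈ℤ^d} e^{−a|z|₁}` in CLOSED FORM -/

/-- d = 0: `K₁ 0 a = 1` (one point, |·|₁ = 0). [folklore] -/
theorem K₁_zero (a : ℝ) : K₁ 0 a = 1 := by
  rw [K₁, tsum_fintype]
  simp [l1]

/-- The product step `K₁ (d+1) a = (1 + e^{−a})/(1 − e^{−a}) · K₁ d a` (a > 0): `ℤ^{d+1} ≃ ℤ × ℤ^d` (`Fin.consEquiv`),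
`e^{−a|z|₁}` factorises, product of absolutely convergent sums (`tsum_mul_tsum_of_summable_norm`). [folklore] -/
theorem K₁_succ {a : ℝ} (ha : 0 < a) (d : ℕ) :
    K₁ (d + 1) a = (1 + Real.exp (-a)) / (1 - Real.exp (-a)) * K₁ d a := by
  have heq : (fun x : Fin (d + 1) → ℤ => Real.exp (-a * l1 x)) ∘ (Fin.consEquiv fun _ => ℤ) =
      fun p : ℤ × (Fin d → ℤ) => Real.exp (-a * |(p.1 : ℝ)|) * Real.exp (-a * l1 p.2) := by
    funext p
    simp only [Function.comp_apply, l1, Fin.consEquiv_apply, Fin.sum_univ_succ, Fin.cons_zero, Fin.cons_succ,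
      ← Real.exp_add]
    ring_nf
  have hf : Summable fun n : ℤ => ‖Real.exp (-a * |(n : ℝ)|)‖ := by
    simpa [Real.norm_eq_abs, abs_of_pos (Real.exp_pos _)] using summable_exp_neg_abs_int ha
  have hg : Summable fun y : Fin d → ℤ => ‖Real.exp (-a * l1 y)‖ := by
    simpa [Real.norm_eq_abs, abs_of_pos (Real.exp_pos _)] using summable_exp_neg_l1 ha d
  have hprod := tsum_mul_tsum_of_summable_norm hf hg
  rw [K₁, K₁, ← tsum_exp_neg_abs_int ha, hprod]
  rw [← Equiv.tsum_eq (Fin.consEquiv fun _ => ℤ)]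
  exact congrArg tsum heq

/-- **`K₁(d, a) = ((1 + e^{−a})/(1 − e^{−a}))^d`** for a > 0 — the cube-sum constant of the (5.10) leaf
(`B12Decay510Window.cubeSumLeaf`) in closed form. [cite: Balaban1987RG1, (5.10) p.293] -/
theorem K₁_eq_pow {a : ℝ} (ha : 0 < a) (d : ℕ) :
    K₁ d a = ((1 + Real.exp (-a)) / (1 - Real.exp (-a))) ^ d := by
  induction d with
  | zero => rw [K₁_zero, pow_zero]
  | succ d ih => rw [K₁_succ ha, ih, pow_succ]; ring

/-- The coth bound `(1 + e^{−a})/(1 − e^{−a}) ≤ 1 + 2/a` for a > 0 (equivalent to `(1 + a)e^{−a} ≤ 1`, i.e.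
`1 + a ≤ e^a`, `Real.add_one_le_exp`). [folklore] -/
theorem ratio_le_one_add {a : ℝ} (ha : 0 < a) : (1 + Real.exp (-a)) / (1 - Real.exp (-a)) ≤ 1 + 2 / a := by
  have hq0 : 0 < Real.exp (-a) := Real.exp_pos _
  have hq1 : Real.exp (-a) < 1 := Real.exp_lt_one_iff.mpr (by linarith)
  have h1q : 0 < 1 - Real.exp (-a) := by linarith
  have hkey : (1 + a) * Real.exp (-a) ≤ 1 := by
    have h1 : a + 1 ≤ Real.exp a := Real.add_one_le_exp a
    have h2 : Real.exp a * Real.exp (-a) = 1 := by rw [← Real.exp_add]; simp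
    nlinarith [hq0]
  rw [div_le_iff₀ h1q]
  have ha' : a ≠ 0 := ha.ne'
  field_simp
  nlinarith [hkey, hq0]

/-- `K₁(d, a) ≤ (1 + 2/a)^d` for a > 0 — an elementary bound with no infinite sum. [folklore] -/
theorem K₁_le_pow {a : ℝ} (ha : 0 < a) (d : ℕ) : K₁ d a ≤ (1 + 2 / a) ^ d := by
  rw [K₁_eq_pow ha]
  have h0 : 0 ≤ (1 + Real.exp (-a)) / (1 - Real.exp (-a)) := by
    have hq1 : Real.exp (-a) < 1 := Real.exp_lt_one_iff.mpr (by linarith)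
    exact div_nonneg (by positivity) (by linarith)
  exact pow_le_pow_left₀ h0 (ratio_le_one_add ha) d

/-! ## 3. The (5.10)·(5.42) majorant sum `Σ_{x∈ℤ^d} |x|₁² e^{−t|x|₁}` (the sum inside `B12Sec2to5.betaPrime510`) -/

/-- `Σ_{x∈ℤ^d} |x|₁² e^{−t|x|₁} ≤ (16/t²) · K₁(d, t/2)` for t > 0 (termwise `s²e^{−ts} ≤ (16/t²)e^{−ts/2}`,
`B12Sec2to5.sq_mul_exp_neg_le`). [cite: Balaban1987RG1, (5.10) p.293] -/
theorem tsum_sq_exp_le_K₁ {t : ℝ} (ht : 0 < t) (d : ℕ) :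
    ∑' x : Fin d → ℤ, l1 x ^ 2 * Real.exp (-t * l1 x) ≤ 16 / t ^ 2 * K₁ d (t / 2) := by
  have h1 := majorant_summable ht d
  have h2 : Summable fun x : Fin d → ℤ => 16 / t ^ 2 * Real.exp (-(t / 2) * l1 x) :=
    (summable_exp_neg_l1 (half_pos ht) d).mul_left (16 / t ^ 2)
  rw [K₁, ← tsum_mul_left]
  exact Summable.tsum_le_tsum (fun x => sq_mul_exp_neg_le ht (l1_nonneg x)) h1 h2

/-- `Σ_{x∈ℤ^d} |x|₁² e^{−t|x|₁} ≤ (16/t²)(1 + 4/t)^d` for t > 0 — ELEMENTARY (no infinite sum). [folklore] -/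
theorem tsum_sq_exp_le_elem {t : ℝ} (ht : 0 < t) (d : ℕ) :
    ∑' x : Fin d → ℤ, l1 x ^ 2 * Real.exp (-t * l1 x) ≤ 16 / t ^ 2 * (1 + 4 / t) ^ d := by
  have h := tsum_sq_exp_le_K₁ ht d
  have hK := K₁_le_pow (half_pos ht) d
  have h4 : (1 : ℝ) + 2 / (t / 2) = 1 + 4 / t := by field_simp; ring
  rw [h4] at hK
  exact h.trans (mul_le_mul_of_nonneg_left hK (by positivity))

/-- `0 ≤ Σ_{x∈ℤ^d} |x|₁² e^{−t|x|₁}`. [folklore] -/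
theorem tsum_sq_exp_nonneg (t : ℝ) (d : ℕ) : 0 ≤ ∑' x : Fin d → ℤ, l1 x ^ 2 * Real.exp (-t * l1 x) :=
  tsum_nonneg fun _ => mul_nonneg (sq_nonneg _) (Real.exp_pos _).le

/-- `β′_d(C, δ₁) = C · Σ_x |x|₁² e^{−δ₁|x|₁} ≤ C · (16/δ₁²)(1 + 4/δ₁)^d` for C ≥ 0, δ₁ > 0: the §5 constant of [I]
(`B12Sec2to5.betaPrime510`) under an elementary majorant. [cite: Balaban1987RG1, (5.10) p.293] -/
theorem betaPrime510_le_elem (d : ℕ) {C δ₁ : ℝ} (hC : 0 ≤ C) (hδ : 0 < δ₁) :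
    betaPrime510 d C δ₁ ≤ C * (16 / δ₁ ^ 2 * (1 + 4 / δ₁) ^ d) := by
  unfold betaPrime510
  exact mul_le_mul_of_nonneg_left (tsum_sq_exp_le_elem hδ d) hC

/-! ## 4. The d = 4 numerals of the window geometry: κ₀ = 64 log 162, K₀ = 2⁶⁴·3²⁵², the three thresholds -/

/-- `e^{64 log 162} = 162⁶⁴`. [folklore] -/
theorem exp_sixtyfour_log : Real.exp (64 * Real.log 162) = 162 ^ 64 := by
  have h : (64 : ℝ) * Real.log 162 = Real.log (162 ^ 64) := by
    rw [Real.log_pow]; norm_num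
  rw [h, Real.exp_log (by positivity)]

/-- **`K₀(4·2⁴, 2·4) = e^{64 log 162}/81 = 162⁶⁴/81 = 2⁶⁴·3²⁵²`** — the window constant of the concrete carrier at d = 4
is an INTEGER (140 decimal digits; `log₁₀ K₀ ≈ 139.50` in the lane certificate, not asserted here). [folklore] -/
theorem K₀_four_eq : K₀ (4 * 2 ^ 4) (2 * 4) = 2 ^ 64 * 3 ^ 252 := by
  have hκ : kappa₀ (4 * 2 ^ 4) (2 * 4) = 64 * Real.log 162 := kappa₀_four
  unfold K₀
  rw [hκ, exp_sixtyfour_log]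
  norm_num

/-- The same with the numerals evaluated in the arguments: `K₀ 64 8 = 2⁶⁴·3²⁵²`. [folklore] -/
theorem K₀_64_8_eq : K₀ 64 8 = 2 ^ 64 * 3 ^ 252 := by
  have hK : K₀ 64 8 = K₀ (4 * 2 ^ 4) (2 * 4) := by norm_num
  rw [hK, K₀_four_eq]

/-- The absolute A₂-threshold at d = 4: `a2ThresholdL 4 = e·9·64·K₀(64,8)² = 576·e·(2⁶⁴·3²⁵²)²` (≈ 1.569·10²⁸² in the
lane certificate). [cite: Balaban1988RG2Cluster, (2.41) p.21] -/
theorem a2ThresholdL_four_eq : a2ThresholdL 4 = 576 * Real.exp 1 * (2 ^ 64 * 3 ^ 252) ^ 2 := by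
  unfold a2ThresholdL
  rw [K₀_four_eq]
  push_cast
  ring

/-- The ε₁-threshold at d = 4 given κ: `eps1ThresholdL 4 κ = (576 · 2⁶⁴3²⁵² · e^{5κ+1})⁻¹`. [cite: Balaban1988RG2Cluster, p.21 (after (2.41))] -/
theorem eps1ThresholdL_four_eq (κ : ℝ) :
    eps1ThresholdL 4 κ = 1 / (576 * (2 ^ 64 * 3 ^ 252) * Real.exp (5 * κ + 1)) := by
  unfold eps1ThresholdL
  rw [K₀_four_eq]
  push_cast
  ring

/-- The κ-threshold at d = 4 for `1 < ℓ ≤ 6` (printed ℓ = ½L with L ≤ 12; the cell's certified transfer factors, e.g.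
`B13.transferFactor_thirteen` 143/45, lie in this range): the Kotecký–Preiss entry dominates the tree-sum entry, so
`kappaThresholdL 4 ℓ = 10(64 log 162 + 1)/(ℓ − 1)` (cf. `CondsL.tree_of_large`). [cite: Balaban1988RG2Cluster, p.21 (after (2.39))] -/
theorem kappaThresholdL_four_of_le_six {ℓ : ℝ} (h1 : 1 < ℓ) (h6 : ℓ ≤ 6) :
    kappaThresholdL 4 ℓ = 10 * (64 * Real.log 162 + 1) / (ℓ - 1) := by
  rw [kappaThresholdL_four]
  apply max_eq_left
  have hlog : 0 ≤ Real.log 162 := Real.log_nonneg (by norm_num)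
  rw [le_div_iff₀ (by linarith)]
  nlinarith [mul_le_mul_of_nonneg_left h6 hlog]

/-- The four numeric conditions of the concrete carrier at d = 4 with the window constant EVALUATED:
`large`: κ + 128 log 162 + 2 ≤ (1 − 8δ)ℓκ; `small`: C₃ε₁e^{5κ+1}·2⁶⁴3²⁵²·576 ≤ 1; `A₂`: 576e(2⁶⁴3²⁵²)² ≤ A₂;
`tree`: 128 log 162 ≤ κ (`RemainderChainLattice.condsL_four_iff` with `K₀_64_8_eq`). [cite: Balaban1988RG2Cluster, p.21 (after (2.39)); Balaban1987RG1, (0.25)–(0.26) p.257] -/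
theorem condsL_four_iff_numerals (c : B13.Consts) (ℓ : ℝ) : CondsL 4 c ℓ ↔
    (c.κ + 2 * (64 * Real.log 162) + 2 ≤ (1 - 8 * c.δ) * ℓ * c.κ) ∧
      (c.C3act * c.ε₁ * Real.exp (5 * c.κ + 1) * (2 ^ 64 * 3 ^ 252) * 9 * 64 ≤ 1) ∧
      (Real.exp 1 * 9 * 64 * (2 ^ 64 * 3 ^ 252) ^ 2 ≤ c.A₂) ∧ (128 * Real.log 162 ≤ c.κ) := by
  rw [condsL_four_iff, K₀_64_8_eq]

/-! ## 5. `K_rem,L` at d = 4 with the numeral, and an ELEMENTARY majorant of `K_rem,L` (general d and d = 4) -/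

/-- d = 4: `remCoeffL 4 M c α₂ B₃ = A₂ · C₃ · (4α₂⁻²B₃² e^{12Mδ₁} · 2⁶⁴3²⁵² · K₁(4, δ₀/2) · Σ_{x∈ℤ⁴}|x|₁²e^{−δ₁|x|₁})`,
`δ₁ = delta1 δ₀ κ (4M) = ½ min{δ₀, κ(4M)⁻¹}` (`RemainderChainLattice.polConstL_four` with `K₀_64_8_eq`). [cite: Balaban1987RG1, (5.10) p.293 and (1.22) p.264] -/
theorem remCoeffL_four_eq (M : ℕ) (c : B13.Consts) (α₂ B₃ : ℝ) :
    remCoeffL 4 M c α₂ B₃ = c.A₂ * c.C3act * (4 / α₂ ^ 2 * B₃ ^ 2 *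
      Real.exp (12 * (M : ℝ) * delta1 c.δ₀ c.κ (4 * (M : ℝ))) * (2 ^ 64 * 3 ^ 252) * K₁ 4 (c.δ₀ / 2) *
      ∑' x : Fin 4 → ℤ, l1 x ^ 2 * Real.exp (-(delta1 c.δ₀ c.κ (4 * (M : ℝ))) * l1 x)) := by
  obtain ⟨hδ, hpol⟩ := polConstL_four M c α₂ B₃
  rw [remCoeffL, B12Sec2to5.betaPrime510, hpol, hδ, K₀_64_8_eq]

/-- **THE ELEMENTARY MAJORANT of `K_rem,L`** [analysis: our name]: the closed formula of `remCoeffL_eq` with the two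
lattice sums replaced by their elementary bounds, `K₁(d, δ₀/2) ≤ (1 + 4/δ₀)^d` (`K₁_le_pow`) and
`Σ_x|x|₁²e^{−δ₁|x|₁} ≤ (16/δ₁²)(1 + 4/δ₁)^d` (`tsum_sq_exp_le_elem`):
`E_rem,L := A₂ · C₃ · (4α₂⁻²B₃² e^{3Mdδ₁} K₀(4·2^d, 2d) (1 + 4/δ₀)^d · (16/δ₁²)(1 + 4/δ₁)^d)`, δ₁ = `deltaL d M c` —
a rational function of the printed letters and their exponentials; no infinite sum, no k. [cite: Balaban1987RG1, (5.10) p.293 and (1.22) p.264] -/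
def elemCoeffL (d M : ℕ) (c : B13.Consts) (α₂ B₃ : ℝ) : ℝ :=
  c.A₂ * c.C3act * (4 / α₂ ^ 2 * B₃ ^ 2 * Real.exp (deltaL d M c * ((M : ℝ) * d) * 3) * K₀ (4 * 2 ^ d) (2 * d) *
    (1 + 4 / c.δ₀) ^ d * (16 / deltaL d M c ^ 2 * (1 + 4 / deltaL d M c) ^ d))

/-- The geometric-analytic prefactor `4α₂⁻²B₃² e^{3Mdδ₁} K₀(4·2^d, 2d)` is ≥ 0. [folklore] -/
theorem prefactor_nonneg (d M : ℕ) (c : B13.Consts) (α₂ B₃ : ℝ) :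
    0 ≤ 4 / α₂ ^ 2 * B₃ ^ 2 * Real.exp (deltaL d M c * ((M : ℝ) * d) * 3) * K₀ (4 * 2 ^ d) (2 * d) := by
  have hK := K₀_pos (4 * 2 ^ d) (2 * d)
  positivity

/-- **`ε₁·K_rem,L ≤ ε₁·E_rem,L`** under the chain's own conditions (`CondsL` gives A₂ ≥ A₂_thr > 0 and κ > 0, `SignsL` gives
C₃ε₁ ≥ 0 and δ₀ > 0, `0 < d`, `0 < M` give δ₁ > 0). [folklore] -/
theorem eps1_mul_remCoeffL_le_elem {M : ℕ} {c : B13.Consts} {ℓ α₂ B₃ : ℝ} (hC : CondsL d c ℓ) (hs : SignsL c α₂ B₃)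
    (hd : 0 < d) (hM : 0 < M) : c.ε₁ * remCoeffL d M c α₂ B₃ ≤ c.ε₁ * elemCoeffL d M c α₂ B₃ := by
  have hδ₁ : 0 < deltaL d M c := deltaL_pos hC hs.δ₀_pos hd hM
  have hδ₀ : 0 < c.δ₀ := hs.δ₀_pos
  have hA₂ : 0 ≤ c.A₂ := le_trans (a2ThresholdL_pos d).le hC.A₂
  have hA : 0 ≤ c.C3act * c.ε₁ := hs.A
  have hP := prefactor_nonneg d M c α₂ B₃
  -- the two lattice sums against their elementary bounds
  have hK : K₁ d (c.δ₀ / 2) ≤ (1 + 4 / c.δ₀) ^ d := by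
    have h := K₁_le_pow (half_pos hδ₀) d
    have h4 : (1 : ℝ) + 2 / (c.δ₀ / 2) = 1 + 4 / c.δ₀ := by field_simp; ring
    rwa [h4] at h
  have hS := tsum_sq_exp_le_elem hδ₁ d
  have hKS : K₁ d (c.δ₀ / 2) * ∑' x : Fin d → ℤ, l1 x ^ 2 * Real.exp (-(deltaL d M c) * l1 x) ≤
      (1 + 4 / c.δ₀) ^ d * (16 / deltaL d M c ^ 2 * (1 + 4 / deltaL d M c) ^ d) :=
    mul_le_mul hK hS (tsum_sq_exp_nonneg _ _) (by positivity)
  have hcore : 4 / α₂ ^ 2 * B₃ ^ 2 * Real.exp (deltaL d M c * ((M : ℝ) * d) * 3) * K₀ (4 * 2 ^ d) (2 * d) *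
        K₁ d (c.δ₀ / 2) * ∑' x : Fin d → ℤ, l1 x ^ 2 * Real.exp (-(deltaL d M c) * l1 x) ≤
      4 / α₂ ^ 2 * B₃ ^ 2 * Real.exp (deltaL d M c * ((M : ℝ) * d) * 3) * K₀ (4 * 2 ^ d) (2 * d) *
        (1 + 4 / c.δ₀) ^ d * (16 / deltaL d M c ^ 2 * (1 + 4 / deltaL d M c) ^ d) := by
    rw [mul_assoc, mul_assoc _ ((1 + 4 / c.δ₀) ^ d)]
    exact mul_le_mul_of_nonneg_left hKS hP
  rw [remCoeffL_eq, elemCoeffL]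
  have hfac : ∀ Z : ℝ, c.ε₁ * (c.A₂ * c.C3act * Z) = c.C3act * c.ε₁ * c.A₂ * Z := fun Z => by ring
  rw [hfac, hfac]
  exact mul_le_mul_of_nonneg_left hcore (mul_nonneg hA hA₂)

/-- d = 4 with the numeral: `E_rem,L = A₂ · C₃ · (4α₂⁻²B₃² e^{12Mδ₁} · 2⁶⁴3²⁵² · (1 + 4/δ₀)⁴ · (16/δ₁²)(1 + 4/δ₁)⁴)`,
`δ₁ = ½ min{δ₀, κ(4M)⁻¹}`. [cite: Balaban1987RG1, (5.10) p.293 and (1.22) p.264] -/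
theorem elemCoeffL_four_eq (M : ℕ) (c : B13.Consts) (α₂ B₃ : ℝ) :
    elemCoeffL 4 M c α₂ B₃ = c.A₂ * c.C3act * (4 / α₂ ^ 2 * B₃ ^ 2 *
      Real.exp (12 * (M : ℝ) * delta1 c.δ₀ c.κ (4 * (M : ℝ))) * (2 ^ 64 * 3 ^ 252) * (1 + 4 / c.δ₀) ^ 4 *
      (16 / delta1 c.δ₀ c.κ (4 * (M : ℝ)) ^ 2 * (1 + 4 / delta1 c.δ₀ c.κ (4 * (M : ℝ))) ^ 4)) := by
  obtain ⟨hδ, -⟩ := polConstL_four M c α₂ B₃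
  have hK : K₀ (4 * 2 ^ 4) (2 * 4) = 2 ^ 64 * 3 ^ 252 := K₀_four_eq
  have hM : ((M : ℝ) * ((4 : ℕ) : ℝ)) = 4 * (M : ℝ) := by push_cast; ring
  unfold elemCoeffL
  rw [hK, hδ, hM]
  ring_nf

/-- **THE k-UNIFORM CONSTANT-FORM REMAINDER BOUND WITH AN ELEMENTARY COEFFICIENT**: a concrete chain (the HYPOTHESIS
structure `RemainderChainLattice.ChainL` — its instance for Bałaban's split is the located leaf list, NOT supplied here)
with the four numeric conditions, `(1 − 10δ)ℓ = 1` and the printed signs gives `|β¹_{k+1}(g_0,…,g_k)| ≤ ε₁ · E_rem,L` for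
EVERY k and EVERY history in `]0,γ]^{k+1}`, `E_rem,L = elemCoeffL d M c α₂ B₃` elementary (`ChainL.abs_beta1_le` ∘
`eps1_mul_remCoeffL_le_elem`). [cite: Balaban1988RG2Cluster, (2.38) p.20; Balaban1987RG1, (5.10) p.293 and (1.22) p.264] -/
theorem ChainL.abs_beta1_le_elem {M : ℕ} {μ ν : Fin d} {β : HBeta} {S : B12Beta.OneLoopSplit β} {γ : ℝ}
    {c : B13.Consts} {ℓ α₂ B₃ : ℝ} (R : ChainL d M μ ν S γ c ℓ α₂ B₃) (hC : CondsL d c ℓ) (h22 : c.R22gen ℓ)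
    (hs : SignsL c α₂ B₃) (hd : 0 < d) (hM : 0 < M) : RemainderConst S γ (c.ε₁ * elemCoeffL d M c α₂ B₃) :=
  fun k p hp => (R.abs_beta1_le hC h22 hs hd hM k p hp).trans (eps1_mul_remCoeffL_le_elem hC hs hd hM)

/-! ## 6. (v1.1) The lattice moments `Σ_{x∈ℤ^d} |x|₁^j e^{−t|x|₁}`, j = 0, 1, 2, EXACTLY (product structure of ℤ^d) -/

/-- `mom₀(t) := (1 + e^{−t})/(1 − e^{−t})` (= `Σ_{m∈ℤ} e^{−t|m|}` for t > 0, §1; = coth(t/2)). [folklore] -/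
def mom₀ (t : ℝ) : ℝ := (1 + Real.exp (-t)) / (1 - Real.exp (-t))

/-- `mom₁(t) := 2e^{−t}/(1 − e^{−t})²` (= `Σ_{m∈ℤ} |m| e^{−t|m|}` for t > 0). [folklore] -/
def mom₁ (t : ℝ) : ℝ := 2 * Real.exp (-t) / (1 - Real.exp (-t)) ^ 2

/-- `mom₂(t) := 2e^{−t}(1 + e^{−t})/(1 − e^{−t})³` (= `Σ_{m∈ℤ} m² e^{−t|m|}` for t > 0). [folklore] -/
def mom₂ (t : ℝ) : ℝ := 2 * Real.exp (-t) * (1 + Real.exp (-t)) / (1 - Real.exp (-t)) ^ 3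

/-- `K₁(d, t) = mom₀(t)^d` (§2 `K₁_eq_pow`, renamed). [folklore] -/
theorem K₁_eq_mom₀_pow {t : ℝ} (ht : 0 < t) (d : ℕ) : K₁ d t = mom₀ t ^ d := K₁_eq_pow ht d

/-- `1 < mom₀ t`, in particular `mom₀ t ≠ 0`, for t > 0. [folklore] -/
theorem one_lt_mom₀ {t : ℝ} (ht : 0 < t) : 1 < mom₀ t := by
  have hq0 : 0 < Real.exp (-t) := Real.exp_pos _
  have hq1 : Real.exp (-t) < 1 := Real.exp_lt_one_iff.mpr (by linarith)
  unfold mom₀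
  rw [lt_div_iff₀ (by linarith)]
  linarith

/-- `0 < mom₁ t` for t > 0. [folklore] -/
theorem mom₁_pos {t : ℝ} (ht : 0 < t) : 0 < mom₁ t := by
  have hq0 : 0 < Real.exp (-t) := Real.exp_pos _
  have hq1 : Real.exp (-t) < 1 := Real.exp_lt_one_iff.mpr (by linarith)
  unfold mom₁
  exact div_pos (by positivity) (by nlinarith)

/-- `0 < mom₂ t` for t > 0. [folklore] -/
theorem mom₂_pos {t : ℝ} (ht : 0 < t) : 0 < mom₂ t := by
  have hq0 : 0 < Real.exp (-t) := Real.exp_pos _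
  have hq1 : Real.exp (-t) < 1 := Real.exp_lt_one_iff.mpr (by linarith)
  have h1 : 0 < 1 - Real.exp (-t) := by linarith
  unfold mom₂
  exact div_pos (by positivity) (pow_pos h1 3)

/-- `Σ_{n≥0} n² qⁿ = q(1 + q)/(1 − q)³` for `0 ≤ q < 1` (from Mathlib's `Σ C(n+2,2)qⁿ = (1−q)⁻³`, `Σ n qⁿ = q(1−q)⁻²`,
`Σ qⁿ = (1−q)⁻¹` and `n² = 2C(n+2,2) − 3n − 2`). [folklore] -/
theorem hasSum_sq_mul_geometric {q : ℝ} (hq0 : 0 ≤ q) (hq1 : q < 1) :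
    HasSum (fun n : ℕ => (n : ℝ) ^ 2 * q ^ n) (q * (1 + q) / (1 - q) ^ 3) := by
  have hnorm : ‖q‖ < 1 := by rwa [Real.norm_of_nonneg hq0]
  have h2 := hasSum_choose_mul_geometric_of_norm_lt_one 2 hnorm
  have h1 := hasSum_coe_mul_geometric_of_norm_lt_one hnorm
  have h0 := hasSum_geometric_of_lt_one hq0 hq1
  have hc : ∀ n : ℕ, (((n + 2).choose 2 : ℕ) : ℝ) = ((n : ℝ) + 2) * ((n : ℝ) + 1) / 2 := by
    intro n
    induction n with
    | zero => norm_num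
    | succ n ih =>
      rw [show n + 1 + 2 = (n + 2) + 1 from rfl, Nat.choose_succ_succ', Nat.choose_one_right, Nat.cast_add, ih]
      push_cast
      ring
  have h := ((h2.mul_left 2).sub (h1.mul_left 3)).sub (h0.mul_left 2)
  have h1q : (1 : ℝ) - q ≠ 0 := by linarith
  have hval : 2 * (1 / (1 - q) ^ (2 + 1)) - 3 * (q / (1 - q) ^ 2) - 2 * (1 - q)⁻¹ = q * (1 + q) / (1 - q) ^ 3 := by
    field_simp
    ring
  rw [hval] at h
  have heq : (fun n : ℕ => (n : ℝ) ^ 2 * q ^ n) =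
      fun b : ℕ => 2 * ((((b + 2).choose 2 : ℕ) : ℝ) * q ^ b) - 3 * ((b : ℝ) * q ^ b) - 2 * q ^ b := by
    funext n
    rw [hc]
    ring
  rw [heq]
  exact h

/-- ℤ-sums from ℕ-sums: for a weight `g` with `g 0 = 0` and `Σ_{n≥0} g(n) qⁿ = s` (q = e^{−t}),
`Σ_{m∈ℤ} g(|m|) e^{−t|m|} = 2s` (`HasSum.of_nat_of_neg_add_one`). [folklore] -/
theorem hasSum_int_of_nat_weight {t : ℝ} (g : ℝ → ℝ) {s : ℝ}
    (h : HasSum (fun n : ℕ => g n * Real.exp (-t) ^ n) s) (h0 : g 0 = 0) :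
    HasSum (fun m : ℤ => g |(m : ℝ)| * Real.exp (-t * |(m : ℝ)|)) (s + s) := by
  have hnat : HasSum (fun n : ℕ => g |((n : ℤ) : ℝ)| * Real.exp (-t * |((n : ℤ) : ℝ)|)) s := by
    convert h using 1
    funext n
    rw [Int.cast_natCast, abs_of_nonneg (Nat.cast_nonneg n), ← Real.exp_nat_mul]
    ring_nf
  have hneg : HasSum (fun n : ℕ => g |(((-(n + 1 : ℤ)) : ℤ) : ℝ)| * Real.exp (-t * |(((-(n + 1 : ℤ)) : ℤ) : ℝ)|)) s := by
    have hs := (hasSum_nat_add_iff' 1).mpr h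
    rw [Finset.sum_range_one, Nat.cast_zero, h0, zero_mul, sub_zero] at hs
    have hn : ∀ n : ℕ, |(((-(n + 1 : ℤ)) : ℤ) : ℝ)| = ((n + 1 : ℕ) : ℝ) := fun n => by
      push_cast
      rw [abs_neg]
      exact abs_of_nonneg (by positivity)
    have heq : (fun n : ℕ => g |(((-(n + 1 : ℤ)) : ℤ) : ℝ)| * Real.exp (-t * |(((-(n + 1 : ℤ)) : ℤ) : ℝ)|)) =
        fun n : ℕ => g ((n + 1 : ℕ) : ℝ) * Real.exp (-t) ^ (n + 1) := by
      funext n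
      rw [hn n, ← Real.exp_nat_mul]
      ring_nf
    rw [heq]
    exact hs
  exact HasSum.of_nat_of_neg_add_one (f := fun m : ℤ => g |(m : ℝ)| * Real.exp (-t * |(m : ℝ)|)) hnat hneg

/-- **`Σ_{m∈ℤ} |m| e^{−t|m|} = 2e^{−t}/(1 − e^{−t})² = mom₁ t`** for t > 0. [folklore] -/
theorem hasSum_abs_mul_exp_neg_abs_int {t : ℝ} (ht : 0 < t) :
    HasSum (fun m : ℤ => |(m : ℝ)| * Real.exp (-t * |(m : ℝ)|)) (mom₁ t) := by
  have hq0 : 0 ≤ Real.exp (-t) := (Real.exp_pos _).le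
  have hnorm : ‖Real.exp (-t)‖ < 1 := by
    rw [Real.norm_of_nonneg hq0]
    exact Real.exp_lt_one_iff.mpr (by linarith)
  have h := hasSum_int_of_nat_weight (t := t) (fun s => s) (hasSum_coe_mul_geometric_of_norm_lt_one hnorm) rfl
  convert h using 1
  unfold mom₁
  ring

/-- **`Σ_{m∈ℤ} m² e^{−t|m|} = 2e^{−t}(1 + e^{−t})/(1 − e^{−t})³ = mom₂ t`** for t > 0. [folklore] -/
theorem hasSum_sq_mul_exp_neg_abs_int {t : ℝ} (ht : 0 < t) :
    HasSum (fun m : ℤ => |(m : ℝ)| ^ 2 * Real.exp (-t * |(m : ℝ)|)) (mom₂ t) := by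
  have hq0 : 0 ≤ Real.exp (-t) := (Real.exp_pos _).le
  have hq1 : Real.exp (-t) < 1 := Real.exp_lt_one_iff.mpr (by linarith)
  have h := hasSum_int_of_nat_weight (t := t) (fun s => s ^ 2) (hasSum_sq_mul_geometric hq0 hq1) (by norm_num)
  convert h using 1
  unfold mom₂
  ring

/-- `Σ_{x∈ℤ^d} |x|₁ e^{−t|x|₁} < ∞` for t > 0 (`|x|₁ ≤ 1 + |x|₁²`). [folklore] -/
theorem summable_l1_mul_exp {t : ℝ} (ht : 0 < t) (d : ℕ) :
    Summable (fun x : Fin d → ℤ => l1 x * Real.exp (-t * l1 x)) := by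
  refine Summable.of_nonneg_of_le (fun x => mul_nonneg (l1_nonneg x) (Real.exp_pos _).le) (fun x => ?_)
    ((summable_exp_neg_l1 ht d).add (majorant_summable ht d))
  have hx := l1_nonneg x
  have he := Real.exp_pos (-t * l1 x)
  nlinarith [sq_nonneg (l1 x - 1), he.le, mul_nonneg (sq_nonneg (l1 x - 1)) he.le]

/-- The product step for the FIRST moment: `S₁(d+1) = mom₁·K₁(d) + mom₀·S₁(d)` (t > 0), from `ℤ^{d+1} ≃ ℤ × ℤ^d`
(`Fin.consEquiv`), `|x|₁ = |m| + |y|₁`, and products of absolutely convergent sums. [folklore] -/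
theorem tsum_l1_mul_exp_succ {t : ℝ} (ht : 0 < t) (d : ℕ) :
    ∑' x : Fin (d + 1) → ℤ, l1 x * Real.exp (-t * l1 x) =
      mom₁ t * K₁ d t + mom₀ t * ∑' y : Fin d → ℤ, l1 y * Real.exp (-t * l1 y) := by
  -- the four one-factor families and their (norm-)summability
  have sf₀ : Summable fun m : ℤ => Real.exp (-t * |(m : ℝ)|) := summable_exp_neg_abs_int ht
  have sf₁ : Summable fun m : ℤ => |(m : ℝ)| * Real.exp (-t * |(m : ℝ)|) := (hasSum_abs_mul_exp_neg_abs_int ht).summable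
  have sg₀ : Summable fun y : Fin d → ℤ => Real.exp (-t * l1 y) := summable_exp_neg_l1 ht d
  have sg₁ : Summable fun y : Fin d → ℤ => l1 y * Real.exp (-t * l1 y) := summable_l1_mul_exp ht d
  have nf₀ : Summable fun m : ℤ => ‖Real.exp (-t * |(m : ℝ)|)‖ := by simpa only [Real.norm_eq_abs] using sf₀.abs
  have nf₁ : Summable fun m : ℤ => ‖|(m : ℝ)| * Real.exp (-t * |(m : ℝ)|)‖ := by
    simpa only [Real.norm_eq_abs] using sf₁.abs
  have ng₀ : Summable fun y : Fin d → ℤ => ‖Real.exp (-t * l1 y)‖ := by simpa only [Real.norm_eq_abs] using sg₀.abs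
  have ng₁ : Summable fun y : Fin d → ℤ => ‖l1 y * Real.exp (-t * l1 y)‖ := by
    simpa only [Real.norm_eq_abs] using sg₁.abs
  -- the integrand on ℤ × ℤ^d
  have heq : (fun x : Fin (d + 1) → ℤ => l1 x * Real.exp (-t * l1 x)) ∘ (Fin.consEquiv fun _ => ℤ) =
      fun p : ℤ × (Fin d → ℤ) => |(p.1 : ℝ)| * Real.exp (-t * |(p.1 : ℝ)|) * Real.exp (-t * l1 p.2) +
        Real.exp (-t * |(p.1 : ℝ)|) * (l1 p.2 * Real.exp (-t * l1 p.2)) := by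
    funext p
    simp only [Function.comp_apply, l1, Fin.consEquiv_apply, Fin.sum_univ_succ, Fin.cons_zero, Fin.cons_succ]
    rw [show -t * (|((p.1 : ℤ) : ℝ)| + ∑ i : Fin d, |((p.2 i : ℤ) : ℝ)|) =
      -t * |((p.1 : ℤ) : ℝ)| + -t * ∑ i : Fin d, |((p.2 i : ℤ) : ℝ)| by ring, Real.exp_add]
    ring
  have s10 : Summable fun p : ℤ × (Fin d → ℤ) =>
      |(p.1 : ℝ)| * Real.exp (-t * |(p.1 : ℝ)|) * Real.exp (-t * l1 p.2) :=
    sf₁.mul_of_nonneg sg₀ (fun _ => mul_nonneg (abs_nonneg _) (Real.exp_pos _).le) (fun _ => (Real.exp_pos _).le)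
  have s01 : Summable fun p : ℤ × (Fin d → ℤ) =>
      Real.exp (-t * |(p.1 : ℝ)|) * (l1 p.2 * Real.exp (-t * l1 p.2)) :=
    sf₀.mul_of_nonneg sg₁ (fun _ => (Real.exp_pos _).le) (fun _ => mul_nonneg (l1_nonneg _) (Real.exp_pos _).le)
  rw [show mom₁ t = ∑' m : ℤ, |(m : ℝ)| * Real.exp (-t * |(m : ℝ)|) from
      ((hasSum_abs_mul_exp_neg_abs_int ht).tsum_eq).symm,
    show mom₀ t = ∑' m : ℤ, Real.exp (-t * |(m : ℝ)|) from (tsum_exp_neg_abs_int ht).symm, K₁,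
    tsum_mul_tsum_of_summable_norm nf₁ ng₀, tsum_mul_tsum_of_summable_norm nf₀ ng₁, ← Summable.tsum_add s10 s01,
    ← Equiv.tsum_eq (Fin.consEquiv fun _ => ℤ)]
  exact congrArg tsum heq

/-- The product step for the SECOND moment: `S₂(d+1) = mom₂·K₁(d) + 2·mom₁·S₁(d) + mom₀·S₂(d)` (t > 0)
(`(|m| + |y|₁)² = m² + 2|m||y|₁ + |y|₁²`). [folklore] -/
theorem tsum_sq_mul_exp_succ {t : ℝ} (ht : 0 < t) (d : ℕ) :
    ∑' x : Fin (d + 1) → ℤ, l1 x ^ 2 * Real.exp (-t * l1 x) =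
      mom₂ t * K₁ d t + 2 * (mom₁ t * ∑' y : Fin d → ℤ, l1 y * Real.exp (-t * l1 y)) +
        mom₀ t * ∑' y : Fin d → ℤ, l1 y ^ 2 * Real.exp (-t * l1 y) := by
  have sf₀ : Summable fun m : ℤ => Real.exp (-t * |(m : ℝ)|) := summable_exp_neg_abs_int ht
  have sf₁ : Summable fun m : ℤ => |(m : ℝ)| * Real.exp (-t * |(m : ℝ)|) := (hasSum_abs_mul_exp_neg_abs_int ht).summable
  have sf₂ : Summable fun m : ℤ => |(m : ℝ)| ^ 2 * Real.exp (-t * |(m : ℝ)|) :=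
    (hasSum_sq_mul_exp_neg_abs_int ht).summable
  have sg₀ : Summable fun y : Fin d → ℤ => Real.exp (-t * l1 y) := summable_exp_neg_l1 ht d
  have sg₁ : Summable fun y : Fin d → ℤ => l1 y * Real.exp (-t * l1 y) := summable_l1_mul_exp ht d
  have sg₂ : Summable fun y : Fin d → ℤ => l1 y ^ 2 * Real.exp (-t * l1 y) := majorant_summable ht d
  have nf₀ : Summable fun m : ℤ => ‖Real.exp (-t * |(m : ℝ)|)‖ := by simpa only [Real.norm_eq_abs] using sf₀.abs
  have nf₁ : Summable fun m : ℤ => ‖|(m : ℝ)| * Real.exp (-t * |(m : ℝ)|)‖ := by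
    simpa only [Real.norm_eq_abs] using sf₁.abs
  have nf₂ : Summable fun m : ℤ => ‖|(m : ℝ)| ^ 2 * Real.exp (-t * |(m : ℝ)|)‖ := by
    simpa only [Real.norm_eq_abs] using sf₂.abs
  have ng₀ : Summable fun y : Fin d → ℤ => ‖Real.exp (-t * l1 y)‖ := by simpa only [Real.norm_eq_abs] using sg₀.abs
  have ng₁ : Summable fun y : Fin d → ℤ => ‖l1 y * Real.exp (-t * l1 y)‖ := by
    simpa only [Real.norm_eq_abs] using sg₁.abs
  have ng₂ : Summable fun y : Fin d → ℤ => ‖l1 y ^ 2 * Real.exp (-t * l1 y)‖ := by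
    simpa only [Real.norm_eq_abs] using sg₂.abs
  have heq : (fun x : Fin (d + 1) → ℤ => l1 x ^ 2 * Real.exp (-t * l1 x)) ∘ (Fin.consEquiv fun _ => ℤ) =
      fun p : ℤ × (Fin d → ℤ) =>
        |(p.1 : ℝ)| ^ 2 * Real.exp (-t * |(p.1 : ℝ)|) * Real.exp (-t * l1 p.2) +
          2 * (|(p.1 : ℝ)| * Real.exp (-t * |(p.1 : ℝ)|) * (l1 p.2 * Real.exp (-t * l1 p.2))) +
          Real.exp (-t * |(p.1 : ℝ)|) * (l1 p.2 ^ 2 * Real.exp (-t * l1 p.2)) := by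
    funext p
    simp only [Function.comp_apply, l1, Fin.consEquiv_apply, Fin.sum_univ_succ, Fin.cons_zero, Fin.cons_succ]
    rw [show -t * (|((p.1 : ℤ) : ℝ)| + ∑ i : Fin d, |((p.2 i : ℤ) : ℝ)|) =
      -t * |((p.1 : ℤ) : ℝ)| + -t * ∑ i : Fin d, |((p.2 i : ℤ) : ℝ)| by ring, Real.exp_add]
    ring
  have s20 : Summable fun p : ℤ × (Fin d → ℤ) =>
      |(p.1 : ℝ)| ^ 2 * Real.exp (-t * |(p.1 : ℝ)|) * Real.exp (-t * l1 p.2) :=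
    sf₂.mul_of_nonneg sg₀ (fun _ => mul_nonneg (sq_nonneg _) (Real.exp_pos _).le) (fun _ => (Real.exp_pos _).le)
  have s11 : Summable fun p : ℤ × (Fin d → ℤ) =>
      |(p.1 : ℝ)| * Real.exp (-t * |(p.1 : ℝ)|) * (l1 p.2 * Real.exp (-t * l1 p.2)) :=
    sf₁.mul_of_nonneg sg₁ (fun _ => mul_nonneg (abs_nonneg _) (Real.exp_pos _).le)
      (fun _ => mul_nonneg (l1_nonneg _) (Real.exp_pos _).le)
  have s11' : Summable fun p : ℤ × (Fin d → ℤ) =>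
      2 * (|(p.1 : ℝ)| * Real.exp (-t * |(p.1 : ℝ)|) * (l1 p.2 * Real.exp (-t * l1 p.2))) := s11.mul_left 2
  have s02 : Summable fun p : ℤ × (Fin d → ℤ) =>
      Real.exp (-t * |(p.1 : ℝ)|) * (l1 p.2 ^ 2 * Real.exp (-t * l1 p.2)) :=
    sf₀.mul_of_nonneg sg₂ (fun _ => (Real.exp_pos _).le) (fun _ => mul_nonneg (sq_nonneg _) (Real.exp_pos _).le)
  rw [show mom₂ t = ∑' m : ℤ, |(m : ℝ)| ^ 2 * Real.exp (-t * |(m : ℝ)|) from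
      ((hasSum_sq_mul_exp_neg_abs_int ht).tsum_eq).symm,
    show mom₁ t = ∑' m : ℤ, |(m : ℝ)| * Real.exp (-t * |(m : ℝ)|) from
      ((hasSum_abs_mul_exp_neg_abs_int ht).tsum_eq).symm,
    show mom₀ t = ∑' m : ℤ, Real.exp (-t * |(m : ℝ)|) from (tsum_exp_neg_abs_int ht).symm, K₁,
    tsum_mul_tsum_of_summable_norm nf₂ ng₀, tsum_mul_tsum_of_summable_norm nf₁ ng₁,
    tsum_mul_tsum_of_summable_norm nf₀ ng₂, ← tsum_mul_left, ← Summable.tsum_add s20 s11',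
    ← Summable.tsum_add (s20.add s11') s02, ← Equiv.tsum_eq (Fin.consEquiv fun _ => ℤ)]
  exact congrArg tsum heq

/-- **`Σ_{x∈ℤ^d} |x|₁ e^{−t|x|₁} = d · mom₁(t) · mom₀(t)^{d−1}`** for t > 0 (induction on d). [folklore] -/
theorem tsum_l1_mul_exp_eq {t : ℝ} (ht : 0 < t) :
    ∀ d : ℕ, ∑' x : Fin d → ℤ, l1 x * Real.exp (-t * l1 x) = d * mom₁ t * mom₀ t ^ (d - 1)
  | 0 => by rw [tsum_fintype]; simp [l1]
  | 1 => by
    rw [tsum_l1_mul_exp_succ ht 0, tsum_l1_mul_exp_eq ht 0, K₁_eq_mom₀_pow ht 0]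
    simp
  | n + 2 => by
    rw [tsum_l1_mul_exp_succ ht (n + 1), tsum_l1_mul_exp_eq ht (n + 1), K₁_eq_mom₀_pow ht (n + 1),
      show n + 1 - 1 = n by omega, show n + 2 - 1 = n + 1 by omega]
    push_cast
    ring

/-- **`Σ_{x∈ℤ^d} |x|₁² e^{−t|x|₁} = d · mom₂(t) · mom₀(t)^{d−1} + d(d−1) · mom₁(t)² · mom₀(t)^{d−2}`** for t > 0 — the sum
inside `B12Sec2to5.betaPrime510` in CLOSED FORM (induction on d; the terms with `d − 1`, `d − 2` vanish where truncated).
[cite: Balaban1987RG1, (5.10) p.293] -/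
theorem tsum_sq_mul_exp_eq {t : ℝ} (ht : 0 < t) :
    ∀ d : ℕ, ∑' x : Fin d → ℤ, l1 x ^ 2 * Real.exp (-t * l1 x) =
      d * mom₂ t * mom₀ t ^ (d - 1) + d * ((d : ℝ) - 1) * mom₁ t ^ 2 * mom₀ t ^ (d - 2)
  | 0 => by rw [tsum_fintype]; simp [l1]
  | 1 => by
    rw [tsum_sq_mul_exp_succ ht 0, tsum_sq_mul_exp_eq ht 0, tsum_l1_mul_exp_eq ht 0, K₁_eq_mom₀_pow ht 0]
    simp
  | 2 => by
    rw [tsum_sq_mul_exp_succ ht 1, tsum_sq_mul_exp_eq ht 1, tsum_l1_mul_exp_eq ht 1, K₁_eq_mom₀_pow ht 1]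
    norm_num
    ring
  | n + 3 => by
    rw [tsum_sq_mul_exp_succ ht (n + 2), tsum_sq_mul_exp_eq ht (n + 2), tsum_l1_mul_exp_eq ht (n + 2),
      K₁_eq_mom₀_pow ht (n + 2), show n + 2 - 1 = n + 1 by omega, show n + 2 - 2 = n by omega,
      show n + 3 - 1 = n + 2 by omega, show n + 3 - 2 = n + 1 by omega]
    push_cast
    ring

/-- d = 4: **`Σ_{x∈ℤ⁴} |x|₁² e^{−t|x|₁} = 4·mom₂·mom₀³ + 12·mom₁²·mom₀²`** (t > 0). [folklore] -/
theorem tsum_sq_mul_exp_four {t : ℝ} (ht : 0 < t) :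
    ∑' x : Fin 4 → ℤ, l1 x ^ 2 * Real.exp (-t * l1 x) = 4 * mom₂ t * mom₀ t ^ 3 + 12 * mom₁ t ^ 2 * mom₀ t ^ 2 := by
  rw [tsum_sq_mul_exp_eq ht 4]
  norm_num

/-- d = 4, all letters spelled out (q = e^{−t}): **`Σ_{x∈ℤ⁴} |x|₁² e^{−t|x|₁} = 8q(1 + q)²(1 + 8q + q²)/(1 − q)⁶`**
(lane two-engine certificate, GAPS C-asym2g16-1 item (b): `352.0289…` at t = 1, `0.83531…` at t = 3 — decimals NOT asserted
here). [folklore] -/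
theorem tsum_sq_mul_exp_four_explicit {t : ℝ} (ht : 0 < t) :
    ∑' x : Fin 4 → ℤ, l1 x ^ 2 * Real.exp (-t * l1 x) =
      8 * Real.exp (-t) * (1 + Real.exp (-t)) ^ 2 * (1 + 8 * Real.exp (-t) + Real.exp (-t) ^ 2) /
        (1 - Real.exp (-t)) ^ 6 := by
  rw [tsum_sq_mul_exp_four ht]
  have hq1 : Real.exp (-t) < 1 := Real.exp_lt_one_iff.mpr (by linarith)
  have h1 : (1 : ℝ) - Real.exp (-t) ≠ 0 := by linarith
  unfold mom₀ mom₁ mom₂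
  field_simp
  ring

/-- **`β′_d(C, δ₁) = C · (d·mom₂(δ₁)·mom₀(δ₁)^{d−1} + d(d−1)·mom₁(δ₁)²·mom₀(δ₁)^{d−2})`** — the §5 constant of [I]
(`B12Sec2to5.betaPrime510`) EXACTLY, no infinite sum (δ₁ > 0). [cite: Balaban1987RG1, (5.10) p.293 and (1.22) p.264] -/
theorem betaPrime510_eq_closed (d : ℕ) (C : ℝ) {δ₁ : ℝ} (hδ : 0 < δ₁) :
    betaPrime510 d C δ₁ =
      C * (d * mom₂ δ₁ * mom₀ δ₁ ^ (d - 1) + d * ((d : ℝ) - 1) * mom₁ δ₁ ^ 2 * mom₀ δ₁ ^ (d - 2)) := by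
  unfold betaPrime510
  rw [tsum_sq_mul_exp_eq hδ d]

/-- d = 4: `β′₄(C, δ₁) = C · 8q(1 + q)²(1 + 8q + q²)/(1 − q)⁶`, q = e^{−δ₁} (δ₁ > 0). [cite: Balaban1987RG1, (5.10) p.293 and (1.22) p.264] -/
theorem betaPrime510_four_eq_closed (C : ℝ) {δ₁ : ℝ} (hδ : 0 < δ₁) :
    betaPrime510 4 C δ₁ = C * (8 * Real.exp (-δ₁) * (1 + Real.exp (-δ₁)) ^ 2 *
      (1 + 8 * Real.exp (-δ₁) + Real.exp (-δ₁) ^ 2) / (1 - Real.exp (-δ₁)) ^ 6) := by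
  unfold betaPrime510
  rw [tsum_sq_mul_exp_four_explicit hδ]

/-- d = 4: **`K_rem,L` with NO infinite sum and NO inequality** — `remCoeffL 4 M c α₂ B₃ = A₂·C₃·(4α₂⁻²B₃² e^{12Mδ₁} ·
2⁶⁴3²⁵² · ((1 + e^{−δ₀/2})/(1 − e^{−δ₀/2}))⁴ · 8q(1 + q)²(1 + 8q + q²)/(1 − q)⁶)`, `q = e^{−δ₁}`,
`δ₁ = delta1 δ₀ κ (4M) = ½ min{δ₀, κ(4M)⁻¹}` (from `remCoeffL_four_eq`, `K₁_eq_pow`, `tsum_sq_mul_exp_four_explicit`;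
needs δ₀ > 0 and δ₁ > 0).  Compare §5 `elemCoeffL_four_eq` (elementary MAJORANT, ×14–63 larger in the lane's table).
[cite: Balaban1987RG1, (5.10) p.293 and (1.22) p.264] -/
theorem remCoeffL_four_eq_closed (M : ℕ) (c : B13.Consts) (α₂ B₃ : ℝ) (hδ₀ : 0 < c.δ₀)
    (hδ₁ : 0 < delta1 c.δ₀ c.κ (4 * (M : ℝ))) :
    remCoeffL 4 M c α₂ B₃ = c.A₂ * c.C3act * (4 / α₂ ^ 2 * B₃ ^ 2 *
      Real.exp (12 * (M : ℝ) * delta1 c.δ₀ c.κ (4 * (M : ℝ))) * (2 ^ 64 * 3 ^ 252) * mom₀ (c.δ₀ / 2) ^ 4 *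
      (8 * Real.exp (-delta1 c.δ₀ c.κ (4 * (M : ℝ))) * (1 + Real.exp (-delta1 c.δ₀ c.κ (4 * (M : ℝ)))) ^ 2 *
        (1 + 8 * Real.exp (-delta1 c.δ₀ c.κ (4 * (M : ℝ))) + Real.exp (-delta1 c.δ₀ c.κ (4 * (M : ℝ))) ^ 2) /
        (1 - Real.exp (-delta1 c.δ₀ c.κ (4 * (M : ℝ)))) ^ 6)) := by
  rw [remCoeffL_four_eq, K₁_eq_mom₀_pow (half_pos hδ₀) 4, tsum_sq_mul_exp_four_explicit hδ₁]

end

end Literature.MathematicalPhysics.QuantumFieldTheory.Balaban1983to89.Beta.RemainderConstNumerals
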